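import Mathlib
import Summits.CriticalPhenomena.Ising3DConformalLimit.Theses.HyperoctahedralRP

/-!
# Sketch — crux-ideate stmt-CriticalPhenomena-1980 (LimitRotationInvariant), ideator 1, round 1

First lemmas of the two idea cards (they need not be proved; they must elaborate).
-/

namespace Summit.CriticalPhenomena.Ising3DConformalLimit.Cruxes.LimitRotationInvariant.Ideator1

open Literature.Probability.LatticeModels

/-- A point of `ℝ³` from its three coordinates. -/
noncomputable def pt (a b c : ℝ) : EuclideanSpace ℝ (Fin 3) :=
  (WithLp.equiv 2 (Fin 3 → ℝ)).symm ![a, b, c]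

/-! ## Card `quarter-turn-moment-problem` — first lemma

Quantise along `e₃`; work in the `(x₁,x₃)`-plane (polar angle from `x₁` towards `x₃`); chamber
`Σ = {0 < x₁ < x₃}` (angles `45°–90°`).  `θ₃ (a,b,c) = (a,b,-c)`, quarter turn
`r (a,b,c) = (-c,b,a)` (`= r_{π/2}`), half turn `r² (a,b,c) = (-a,b,-c)`.  For chamber point sets
`A, B` put `k_α(A,B) := S(θ₃A ⊔ r_α B)`.  The four coplanar lattice reflection positivities are
positive-semidefiniteness of `k_α` at the nodes `α ∈ {-π/2, 0, π/2, π}` (mirror at angle `α/2`);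
in any OS theory in which the quarter turn is a symmetry, `k_α = ⟨ψ, e^{-αK} ψ'⟩` for ONE
self-adjoint `K` (Fröhlich–Osterwalder–Seiler; `e^{-πK} = Δ^{1/2}`, Bisognano–Wichmann), hence
the nodes INTERLACE by Cauchy–Schwarz across different mirrors:
`|k_{π/2}(F,G)|² ≤ k_0(F,F) · k_π(G,G)` (I1).  Degree 1 reduces to `1 ≥ sin(φ-χ)`; the rank-one
degree-2 instance below is the first new checkable statement of the line. -/
def QuarterTurnInterlacing : Prop :=
  ∀ (ρ : ℝ → ℝ) (Δ : ℝ) (S : CorrFamily 3), (∀ δ ∈ Set.Ioc (0:ℝ) 1, 0 < ρ δ) →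
    HasPointwiseScalingLimit (criticalCorr 3) ρ S →
    (∀ n z, z ∉ NonCoincident 3 n → S n z = 0) → IsNondegenerateTwoPoint S →
    IsTranslationInvariant S → IsScaleCovariant Δ S →
    ∀ (x₁ x₂ x₃ y₁ y₂ y₃ u₁ u₂ u₃ v₁ v₂ v₃ : ℝ),
      0 < x₁ → x₁ < x₃ → 0 < y₁ → y₁ < y₃ → 0 < u₁ → u₁ < u₃ → 0 < v₁ → v₁ < v₃ →
      pt x₁ x₂ x₃ ≠ pt y₁ y₂ y₃ → pt u₁ u₂ u₃ ≠ pt v₁ v₂ v₃ →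
      (S 4 ![pt x₁ x₂ (-x₃), pt y₁ y₂ (-y₃), pt (-u₃) u₂ u₁, pt (-v₃) v₂ v₁]) ^ 2 ≤
        S 4 ![pt x₁ x₂ (-x₃), pt y₁ y₂ (-y₃), pt x₁ x₂ x₃, pt y₁ y₂ y₃] *
        S 4 ![pt u₁ u₂ (-u₃), pt v₁ v₂ (-v₃), pt (-u₁) u₂ (-u₃), pt (-v₁) v₂ (-v₃)]

/-- The degree-1 (two-point) interlacing inequality is elementary once `S₂ = c‖·‖^{-2Δ}`:
`((x₁+u₃)²+(x₃+u₁)²+ (x₂-u₂)²)^{-2Δ} ≤ (2x₃)^{-2Δ} (2u₁)^{-2Δ}` by AM–GM. -/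
def QuarterTurnInterlacingTwoPoint : Prop :=
  ∀ (Δ x₁ x₂ x₃ u₁ u₂ u₃ : ℝ), 0 < Δ → 0 < x₁ → x₁ < x₃ → 0 < u₁ → u₁ < u₃ →
    (‖pt x₁ x₂ (-x₃) - pt (-u₃) u₂ u₁‖ ^ (-(2 * Δ))) ^ 2 ≤
      ‖pt x₁ x₂ (-x₃) - pt x₁ x₂ x₃‖ ^ (-(2 * Δ)) * ‖pt u₁ u₂ (-u₃) - pt (-u₁) u₂ (-u₃)‖ ^ (-(2 * Δ))

/-! ## Card `nine-plane-sharp-markov` — first lemma (pure algebra, provable now)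

Sharp (order-1) Markov property in direction `n` of a stationary Gaussian field forces the
inverse spectral density to be quadratic along every `n`-pencil.  Three coordinate directions
leave the multi-quadratic loophole `(1+k₁²)(1+k₂²)(1+k₃²)` (anisotropic, O_h-symmetric); the six
face diagonals close it: -/
def NinePencilQuadraticIsQuadratic : Prop :=
  ∀ (P : MvPolynomial (Fin 3) ℝ),
    (∀ i : Fin 3, MvPolynomial.degreeOf i P ≤ 2) →
    (∀ (i j : Fin 3), i ≠ j → ∀ (k : Fin 3 → ℝ) (s : ℝ), (s = 1 ∨ s = -1) →
      (MvPolynomial.aeval (fun m : Fin 3 =>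
          Polynomial.C (k m) + (if m = i then Polynomial.X else if m = j then Polynomial.C s * Polynomial.X else 0)) P).natDegree ≤ 2) →
    (MvPolynomial.aeval (fun m : Fin 3 => -(MvPolynomial.X m : MvPolynomial (Fin 3) ℝ)) P = P) →
    P.totalDegree ≤ 2

/-- Consequence with cubic symmetry: an even, permutation- and sign-symmetric polynomial of total
degree ≤ 2 is `a + b‖k‖²` — the inverse spectral density of the (massive or massless) FREE field,
isotropic. -/
def QuadraticCubicInvariantIsRound : Prop :=
  ∀ (P : MvPolynomial (Fin 3) ℝ), P.totalDegree ≤ 2 →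
    (∀ σ : Equiv.Perm (Fin 3), MvPolynomial.rename σ P = P) →
    (∀ i : Fin 3, MvPolynomial.aeval (fun j : Fin 3 =>
        if j = i then -(MvPolynomial.X j : MvPolynomial (Fin 3) ℝ) else MvPolynomial.X j) P = P) →
    ∃ a b : ℝ, P = MvPolynomial.C a +
      MvPolynomial.C b * (MvPolynomial.X 0 ^ 2 + MvPolynomial.X 1 ^ 2 + MvPolynomial.X 2 ^ 2)

/-! ## Shared tool — the closed-subgroup dichotomy (one extra rotation suffices) -/
def OneExtraIsometrySuffices : Prop :=
  ∀ (S : CorrFamily 3) (n : ℕ), (∀ z, ContinuousAt (S n) z ∨ z ∉ NonCoincident 3 n) →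
    (∀ (R : EuclideanSpace ℝ (Fin 3) ≃ₗᵢ[ℝ] EuclideanSpace ℝ (Fin 3)),
      (∀ i : Fin 3, ∃ j : Fin 3, R (EuclideanSpace.single i 1) = EuclideanSpace.single j 1 ∨
        R (EuclideanSpace.single i 1) = -EuclideanSpace.single j 1) →
      ∀ x, S n (fun i => R (x i)) = S n x) →
    (∃ (R₀ : EuclideanSpace ℝ (Fin 3) ≃ₗᵢ[ℝ] EuclideanSpace ℝ (Fin 3)),
      (¬ ∀ i : Fin 3, ∃ j : Fin 3, R₀ (EuclideanSpace.single i 1) = EuclideanSpace.single j 1 ∨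
        R₀ (EuclideanSpace.single i 1) = -EuclideanSpace.single j 1) ∧
      ∀ x, S n (fun i => R₀ (x i)) = S n x) →
    ∀ (R : EuclideanSpace ℝ (Fin 3) ≃ₗᵢ[ℝ] EuclideanSpace ℝ (Fin 3)) x,
      S n (fun i => R (x i)) = S n x

end Summit.CriticalPhenomena.Ising3DConformalLimit.Cruxes.LimitRotationInvariant.Ideator1
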